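import Mathlib.Tactic
import HarnessLib

/-!
# T-instance #7c, §4 RUN in the kernel: the blow-up `Bl_L S′` of bed #7c has NO singular geometric point, identically for every characteristic with `2, 3, 1048549`
# invertible — and `0 ∈ X` is an isolated singular point for the same characteristics
# (crux `FInjectiveMacaulayfication` stmt-ResolutionOfSingularities-15315, chain w45a; res-L1-w45a-plan-1 R23.32 (b) «RUN §4» / R23.34 «kernel port, bankable»;
# memo `Cruxes/…/Lines/T-instance7c-design.md` §6; seat res-L1-w45a-lead-1 g13)

[OURS · L1 W4.5a] Support file (`--supports stmt-ResolutionOfSingularities-15315 --as helper`); def-free; UNCONDITIONAL; no named fact; NOT a statement of any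
manuscript. Field-arithmetic certificates (no Gröbner basis): the eliminations of the memo, step by step, over an ARBITRARY field in which `2`, `3` and
`1048549 = 2²⁰ − 27` are non-zero (so over every algebraically closed field of characteristic `p ∉ {2, 3, 1048549}` — geometric points). AI-written (AI review is
weaker than expert review). Nothing of the crux is proved here.

THE BED #7c: `f = x₁⁴ + x₂⁴ + x₃⁴ + x₁x₂x₄x₅³ + x₄⁸ + x₅⁸` (quasi-homogeneous, weights `(2,2,2,1,1)`), `S′ = Bl_0 {f = 0}`, `Sing S′ = L = ℙ⟨e₄,e₅⟩`; `Bl_L S′` is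
covered by the relative affine cones' charts, whose total spaces are `W_y = {u₁⁴ + u₂⁴ + u₃⁴ + 1 + s⁸ + s·u₁u₂ = 0}` (over `L ∖ [e₄]`) and
`W_z = {u₁⁴ + u₂⁴ + u₃⁴ + 1 + r⁸ + r³·u₁u₂ = 0}` (over `L ∖ [e₅]`), times `𝔸¹`; the `y = 0 / z = 0` charts carry no singular point (`Σuᵢ⁴ = 0 = 4uᵢ³` forces `u = 0`).
* ★ `no_singular_point_Wy`, ★ `no_singular_point_Wz` — the Jacobian systems of `W_y`, `W_z` have NO solution: `Bl_{Sing_red} S′` is regular in ONE step, for the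
  FULL primes (`p ≡ 1 mod 4`) and the non-FULL primes (`p ≡ 3 mod 4`) alike (the DATUM of R23.32: the FULL/non-FULL split is invisible to the recipe);
* ★ `singular_point_X_eq_zero` — the Jacobian system of `f` has only the zero solution: `0` is an isolated singular point of `X`;
* `no_projective_solution_fermat` — the `y = 0` charts: `Σuᵢ⁴ = 0 ∧ 4uᵢ³ = 0 ⇒ u = 0`.
[OURS computation; cite: Fedder1983 (context: the FULL classes `p ≡ 1 (4)` of the memo are not used here)]
-/

-- single-problem summit: the doubled namespace component is forced
set_option linter.dupNamespace false

namespace Summit.ResolutionOfSingularities.ResolutionOfSingularities.Theorems.FInjectiveMacaulayfication.Instance7cBlLCharts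

variable {k : Type} [Field k]

/-- `(4 : k) ≠ 0`, `(8 : k) ≠ 0`, `(64 : k) ≠ 0`, `(12 : k) ≠ 0` from `2, 3 ≠ 0`. [plumbing] -/
theorem units_aux (h2 : (2 : k) ≠ 0) (h3 : (3 : k) ≠ 0) : (4 : k) ≠ 0 ∧ (8 : k) ≠ 0 ∧ (64 : k) ≠ 0 ∧ (12 : k) ≠ 0 := by
  refine ⟨?_, ?_, ?_, ?_⟩
  · rw [show (4 : k) = 2 ^ 2 by norm_num]; exact pow_ne_zero 2 h2
  · rw [show (8 : k) = 2 ^ 3 by norm_num]; exact pow_ne_zero 3 h2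
  · rw [show (64 : k) = 2 ^ 6 by norm_num]; exact pow_ne_zero 6 h2
  · rw [show (12 : k) = 2 ^ 2 * 3 by norm_num]; exact mul_ne_zero (pow_ne_zero 2 h2) h3

/-- ★ **`W_y = {u₁⁴ + u₂⁴ + u₃⁴ + 1 + s⁸ + s u₁u₂ = 0}` has no singular point** over any field with `2, 3, 2²⁰ − 27` invertible. [OURS computation] -/
theorem no_singular_point_Wy (h2 : (2 : k) ≠ 0) (h3 : (3 : k) ≠ 0) (hN : (1048549 : k) ≠ 0) (u₁ u₂ u₃ s : k)
    (hQ : u₁ ^ 4 + u₂ ^ 4 + u₃ ^ 4 + 1 + s ^ 8 + s * u₁ * u₂ = 0)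
    (h1 : 4 * u₁ ^ 3 + s * u₂ = 0) (h2' : 4 * u₂ ^ 3 + s * u₁ = 0) (h3' : 4 * u₃ ^ 3 = 0) (hs : 8 * s ^ 7 + u₁ * u₂ = 0) : False := by
  obtain ⟨h4, h8, h64, h12⟩ := units_aux h2 h3
  have hu₃ : u₃ = 0 := by
    have : u₃ ^ 3 = 0 := (mul_eq_zero.mp h3').resolve_left h4
    exact pow_eq_zero_iff (n := 3) (by norm_num) |>.mp this
  have hB : 4 * u₁ ^ 4 = 8 * s ^ 8 := by linear_combination u₁ * h1 - s * hs
  have hC : 4 * u₂ ^ 4 = 8 * s ^ 8 := by linear_combination u₂ * h2' - s * hs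
  have hD : 12 * s ^ 8 = 4 := by linear_combination (-4) * hQ + hB + hC + 4 * s * hs + 4 * u₃ ^ 3 * hu₃
  have hA : u₁ * u₂ = -8 * s ^ 7 := by linear_combination hs
  have hE : 64 * s ^ 16 = 65536 * s ^ 28 := by
    have h16 : (4 * u₁ ^ 4) * (4 * u₂ ^ 4) = 16 * (u₁ * u₂) ^ 4 := by ring
    rw [hB, hC, hA] at h16
    linear_combination h16
  have hs0 : s ≠ 0 := by
    rintro rfl
    apply h4
    linear_combination -hD
  -- `1024 s¹² = 1` and `3 s⁸ = 1`
  have hF : 1024 * s ^ 12 = 1 := by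
    have h' : 64 * s ^ 16 * (1024 * s ^ 12 - 1) = 0 := by linear_combination -hE
    rcases mul_eq_zero.mp h' with h'' | h''
    · exact absurd ((mul_eq_zero.mp h'').resolve_left h64) (pow_ne_zero 16 hs0)
    · linear_combination h''
  have hG : 3 * s ^ 8 = 1 := by
    have h' : (4 : k) * (3 * s ^ 8 - 1) = 0 := by linear_combination hD
    linear_combination (mul_eq_zero.mp h').resolve_left h4
  -- `27 s²⁴ = 1 = 2²⁰ s²⁴`
  have hH : (1048549 : k) * s ^ 24 = 0 := by linear_combination (1024 * s ^ 12 + 1) * hF - (9 * s ^ 16 + 3 * s ^ 8 + 1) * hG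
  rcases mul_eq_zero.mp hH with h | h
  · exact hN h
  · exact hs0 (pow_eq_zero_iff (n := 24) (by norm_num) |>.mp h)

/-- ★ **`W_z = {u₁⁴ + u₂⁴ + u₃⁴ + 1 + r⁸ + r³ u₁u₂ = 0}` has no singular point** over any field with `2, 3, 2²⁰ − 27` invertible. [OURS computation] -/
theorem no_singular_point_Wz (h2 : (2 : k) ≠ 0) (h3 : (3 : k) ≠ 0) (hN : (1048549 : k) ≠ 0) (u₁ u₂ u₃ r : k)
    (hQ : u₁ ^ 4 + u₂ ^ 4 + u₃ ^ 4 + 1 + r ^ 8 + r ^ 3 * u₁ * u₂ = 0)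
    (h1 : 4 * u₁ ^ 3 + r ^ 3 * u₂ = 0) (h2' : 4 * u₂ ^ 3 + r ^ 3 * u₁ = 0) (h3' : 4 * u₃ ^ 3 = 0) (hr : 8 * r ^ 7 + 3 * r ^ 2 * (u₁ * u₂) = 0) :
    False := by
  obtain ⟨h4, h8, h64, h12⟩ := units_aux h2 h3
  have hu₃ : u₃ = 0 := by
    have : u₃ ^ 3 = 0 := (mul_eq_zero.mp h3').resolve_left h4
    exact pow_eq_zero_iff (n := 3) (by norm_num) |>.mp this
  have hB : 4 * u₁ ^ 4 + r ^ 3 * (u₁ * u₂) = 0 := by linear_combination u₁ * h1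
  have hC : 4 * u₂ ^ 4 + r ^ 3 * (u₁ * u₂) = 0 := by linear_combination u₂ * h2'
  have hr0 : r ≠ 0 := by
    rintro rfl
    have hu₁ : u₁ = 0 := by
      have : u₁ ^ 4 = 0 := (mul_eq_zero.mp (show 4 * u₁ ^ 4 = 0 by linear_combination hB)).resolve_left h4
      exact pow_eq_zero_iff (n := 4) (by norm_num) |>.mp this
    have hu₂ : u₂ = 0 := by
      have : u₂ ^ 4 = 0 := (mul_eq_zero.mp (show 4 * u₂ ^ 4 = 0 by linear_combination hC)).resolve_left h4
      exact pow_eq_zero_iff (n := 4) (by norm_num) |>.mp this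
    subst hu₁; subst hu₂; subst hu₃
    norm_num at hQ
  -- `3 u₁u₂ = −8 r⁵`, `3 u₁⁴ = 2 r⁸ = 3 u₂⁴`, `r⁸ = 3`
  have hA : 3 * (u₁ * u₂) = -8 * r ^ 5 := by
    have h' : r ^ 2 * (3 * (u₁ * u₂) + 8 * r ^ 5) = 0 := by linear_combination hr
    linear_combination (mul_eq_zero.mp h').resolve_left (pow_ne_zero 2 hr0)
  have hB' : 3 * u₁ ^ 4 = 2 * r ^ 8 := by
    have h' : (4 : k) * (3 * u₁ ^ 4 - 2 * r ^ 8) = 0 := by linear_combination 3 * hB - r ^ 3 * hA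
    linear_combination (mul_eq_zero.mp h').resolve_left h4
  have hC' : 3 * u₂ ^ 4 = 2 * r ^ 8 := by
    have h' : (4 : k) * (3 * u₂ ^ 4 - 2 * r ^ 8) = 0 := by linear_combination 3 * hC - r ^ 3 * hA
    linear_combination (mul_eq_zero.mp h').resolve_left h4
  have hD : r ^ 8 = 3 := by linear_combination (-3) * hQ + hB' + hC' + r ^ 3 * hA + 3 * u₃ ^ 3 * hu₃
  -- `81 (u₁u₂)⁴ = 36 r¹⁶ = 4096 r²⁰`
  have hE : 36 * r ^ 16 = 4096 * r ^ 20 := by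
    have h16 : (3 * (u₁ * u₂)) ^ 4 = 9 * (3 * u₁ ^ 4) * (3 * u₂ ^ 4) := by ring
    rw [hA, hB', hC'] at h16
    linear_combination -h16
  have hF : 9 = 1024 * r ^ 4 := by
    have h' : 4 * r ^ 16 * (9 - 1024 * r ^ 4) = 0 := by linear_combination hE
    rcases mul_eq_zero.mp h' with h'' | h''
    · exact absurd ((mul_eq_zero.mp h'').resolve_left h4) (pow_ne_zero 16 hr0)
    · linear_combination h''
  -- `81 = 2²⁰ r⁸ = 3·2²⁰`
  have hH : (3 : k) * 1048549 = 0 := by linear_combination (-(9 + 1024 * r ^ 4)) * hF - 1048576 * hD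
  rcases mul_eq_zero.mp hH with h | h
  · exact h3 h
  · exact hN h

/-- The `y = 0` (resp. `z = 0`) charts of `Bl_L S′` carry no singular point: `Σuᵢ⁴ = 0` with all `4uᵢ³ = 0` forces `u = 0`, which is not a point of the chart
(the exceptional coordinate equation reads `… + 1 = 0` there) — stated as: the projective Fermat quartic `{x₁⁴+x₂⁴+x₃⁴ = 0}` has no singular point. [OURS computation] -/
theorem no_projective_solution_fermat (h2 : (2 : k) ≠ 0) (u₁ u₂ u₃ : k) (h1 : 4 * u₁ ^ 3 = 0) (h2' : 4 * u₂ ^ 3 = 0) (h3' : 4 * u₃ ^ 3 = 0) :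
    u₁ = 0 ∧ u₂ = 0 ∧ u₃ = 0 := by
  have h4 : (4 : k) ≠ 0 := by rw [show (4 : k) = 2 ^ 2 by norm_num]; exact pow_ne_zero 2 h2
  refine ⟨?_, ?_, ?_⟩
  · exact pow_eq_zero_iff (n := 3) (by norm_num) |>.mp ((mul_eq_zero.mp h1).resolve_left h4)
  · exact pow_eq_zero_iff (n := 3) (by norm_num) |>.mp ((mul_eq_zero.mp h2').resolve_left h4)
  · exact pow_eq_zero_iff (n := 3) (by norm_num) |>.mp ((mul_eq_zero.mp h3').resolve_left h4)

/-- ★ **`0` is an isolated singular point of `X = {x₁⁴ + x₂⁴ + x₃⁴ + x₁x₂x₄x₅³ + x₄⁸ + x₅⁸ = 0}`**: the five partial derivatives vanish simultaneously only at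
the origin, over any field with `2, 3, 2²⁰ − 27` invertible (by quasi-homogeneity `f` itself then vanishes too). [OURS computation] -/
theorem singular_point_X_eq_zero (h2 : (2 : k) ≠ 0) (h3 : (3 : k) ≠ 0) (hN : (1048549 : k) ≠ 0) (x₁ x₂ x₃ x₄ x₅ : k)
    (d1 : 4 * x₁ ^ 3 + x₂ * x₄ * x₅ ^ 3 = 0) (d2 : 4 * x₂ ^ 3 + x₁ * x₄ * x₅ ^ 3 = 0) (d3 : 4 * x₃ ^ 3 = 0)
    (d4 : x₁ * x₂ * x₅ ^ 3 + 8 * x₄ ^ 7 = 0) (d5 : 3 * x₁ * x₂ * x₄ * x₅ ^ 2 + 8 * x₅ ^ 7 = 0) :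
    x₁ = 0 ∧ x₂ = 0 ∧ x₃ = 0 ∧ x₄ = 0 ∧ x₅ = 0 := by
  obtain ⟨h4, h8, h64, h12⟩ := units_aux h2 h3
  have hx₃ : x₃ = 0 := pow_eq_zero_iff (n := 3) (by norm_num) |>.mp ((mul_eq_zero.mp d3).resolve_left h4)
  by_cases hx₅ : x₅ = 0
  · subst hx₅
    have hx₄ : x₄ = 0 := by
      have : x₄ ^ 7 = 0 := (mul_eq_zero.mp (show 8 * x₄ ^ 7 = 0 by linear_combination d4)).resolve_left h8
      exact pow_eq_zero_iff (n := 7) (by norm_num) |>.mp this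
    subst hx₄
    have hx₁ : x₁ = 0 := by
      have : x₁ ^ 3 = 0 := (mul_eq_zero.mp (show 4 * x₁ ^ 3 = 0 by linear_combination d1)).resolve_left h4
      exact pow_eq_zero_iff (n := 3) (by norm_num) |>.mp this
    have hx₂ : x₂ = 0 := by
      have : x₂ ^ 3 = 0 := (mul_eq_zero.mp (show 4 * x₂ ^ 3 = 0 by linear_combination d2)).resolve_left h4
      exact pow_eq_zero_iff (n := 3) (by norm_num) |>.mp this
    exact ⟨hx₁, hx₂, hx₃, rfl, rfl⟩
  · exfalso
    -- `3 x₁x₂x₄ = −8 x₅⁵`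
    have hA : 3 * (x₁ * x₂ * x₄) = -8 * x₅ ^ 5 := by
      have h' : x₅ ^ 2 * (3 * (x₁ * x₂ * x₄) + 8 * x₅ ^ 5) = 0 := by linear_combination d5
      linear_combination (mul_eq_zero.mp h').resolve_left (pow_ne_zero 2 hx₅)
    -- `3 x₄⁸ = x₅⁸`, `3 x₁⁴ = 2 x₅⁸ = 3 x₂⁴`
    have hB : 3 * x₄ ^ 8 = x₅ ^ 8 := by
      have h' : (8 : k) * (3 * x₄ ^ 8 - x₅ ^ 8) = 0 := by linear_combination 3 * x₄ * d4 - x₅ ^ 3 * hA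
      linear_combination (mul_eq_zero.mp h').resolve_left h8
    have hC : 3 * x₁ ^ 4 = 2 * x₅ ^ 8 := by
      have h' : (4 : k) * (3 * x₁ ^ 4 - 2 * x₅ ^ 8) = 0 := by linear_combination 3 * x₁ * d1 - x₅ ^ 3 * hA
      linear_combination (mul_eq_zero.mp h').resolve_left h4
    have hD : 3 * x₂ ^ 4 = 2 * x₅ ^ 8 := by
      have h' : (4 : k) * (3 * x₂ ^ 4 - 2 * x₅ ^ 8) = 0 := by linear_combination 3 * x₂ * d2 - x₅ ^ 3 * hA
      linear_combination (mul_eq_zero.mp h').resolve_left h4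
    -- `(3x₁x₂x₄)⁴·9 = 81 x₁⁴x₂⁴x₄⁴·9 = 36·9 x₅¹⁶ x₄⁴`… : `36 x₅¹⁶ x₄⁴ = 4096 x₅²⁰`
    have hE : 36 * x₅ ^ 16 * x₄ ^ 4 = 4096 * x₅ ^ 20 := by
      have h16 : (3 * (x₁ * x₂ * x₄)) ^ 4 = 9 * (3 * x₁ ^ 4) * (3 * x₂ ^ 4) * x₄ ^ 4 := by ring
      rw [hA, hC, hD] at h16
      linear_combination -h16
    have hF : 9 * x₄ ^ 4 = 1024 * x₅ ^ 4 := by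
      have h' : 4 * x₅ ^ 16 * (9 * x₄ ^ 4 - 1024 * x₅ ^ 4) = 0 := by linear_combination hE
      rcases mul_eq_zero.mp h' with h'' | h''
      · exact absurd ((mul_eq_zero.mp h'').resolve_left h4) (pow_ne_zero 16 hx₅)
      · linear_combination h''
    -- `81 x₄⁸ = 2²⁰ x₅⁸` and `81 x₄⁸ = 27 x₅⁸`
    have hH : (1048549 : k) * x₅ ^ 8 = 0 := by linear_combination 27 * hB - (9 * x₄ ^ 4 + 1024 * x₅ ^ 4) * hF
    rcases mul_eq_zero.mp hH with h | h
    · exact hN h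
    · exact hx₅ (pow_eq_zero_iff (n := 8) (by norm_num) |>.mp h)

end Summit.ResolutionOfSingularities.ResolutionOfSingularities.Theorems.FInjectiveMacaulayfication.Instance7cBlLCharts
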